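import Literature.Probability.RandomPlanarGeometry.StarHullClusters
import Literature.Probability.RandomPlanarGeometry.SLERestrictionLemmas
import Mathlib.Topology.MetricSpace.HausdorffDistance
import HarnessLib

/-!
# Partial contacts of the closed Loewner hull with the clusters of a hull: definitions

Topic `Probability/RandomPlanarGeometry`; definitions + unfolding lemmas. In the proof of the
locality of chordal SLE₆ with respect to a `*`-hull `A` (Lawler–Schramm–Werner (2001) Thm. 2.2;
G. F. Lawler (2005) §6.3 Thm. 6.13) the conformal image of the curve is followed THROUGH the
instants at which the Loewner hull swallows whole `ρ`-clusters of `A` (`StarHullClusters`), up to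
a horizon before which every cluster is either untouched — with margin `ρ`: the closed hull misses
its closed `ρ`-neighbourhood in `ℍ̄` — or swallowed whole. This file fixes the vocabulary:

* `Loewner.halfNhd C ρ = {z : 0 ≤ Im z, infDist z C ≤ ρ}` — the closed `ρ`-neighbourhood of `C`
  in the closed half-plane (the "sensor" of the cluster `C`);
* `Loewner.IsPartialContact W C ρ t` — at time `t` the closed hull `K̂_t = closedHull W t` meets
  the sensor of `C` while `C ⊄ K̂_t`;
* `Loewner.clusterContactTime W C ρ = inf {t | IsPartialContact W C ρ t} ∈ [0, ∞]`;
* `Loewner.clusterFamily A ρ` — the (finite) set of `ρ`-clusters of `A`;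
* `Loewner.partialContactTime W A ρ` — the minimum over the clusters of their contact times: the
  first time some cluster of `A` is partially contacted.

## References

* G. F. Lawler, *Conformally Invariant Processes in the Plane* (2005), §6.3 Thm. 6.13. [Lawler2005]
* G. F. Lawler, O. Schramm, W. Werner, Acta Math. 187 (2001), Thm. 2.2. [LawlerSchrammWerner2001]
-/

noncomputable section

open Set Filter Topology Metric Bornology Complex
open UpperHalfPlane (upperHalfPlaneSet)
open scoped NNReal

namespace Literature.Probability.RandomPlanarGeometry

namespace Loewner

variable {W : ℝ≥0 → ℝ} {A C : Set ℂ} {ρ : ℝ} {z : ℂ}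

/-! ### The closed `ρ`-neighbourhood of a set in the closed half-plane -/

/-- The **sensor** of `C`: its closed `ρ`-neighbourhood `{z : 0 ≤ Im z, infDist z C ≤ ρ}` in the
closed half-plane. [folklore] -/
def halfNhd (C : Set ℂ) (ρ : ℝ) : Set ℂ := {z : ℂ | 0 ≤ z.im ∧ infDist z C ≤ ρ}

/-- Unfolding of membership in the sensor. [folklore] -/
theorem mem_halfNhd_iff : z ∈ halfNhd C ρ ↔ 0 ≤ z.im ∧ infDist z C ≤ ρ := Iff.rfl

/-- The sensor is closed. [folklore] -/
theorem isClosed_halfNhd (C : Set ℂ) (ρ : ℝ) : IsClosed (halfNhd C ρ) :=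
  (isClosed_le continuous_const Complex.continuous_im).inter
    (isClosed_le (continuous_infDist_pt C) continuous_const)

/-- The sensor lies in the closed half-plane. [folklore] -/
theorem halfNhd_subset_closure (C : Set ℂ) (ρ : ℝ) : halfNhd C ρ ⊆ closure upperHalfPlaneSet := by
  intro z hz
  rw [show upperHalfPlaneSet = {z : ℂ | 0 < z.im} from rfl, closure_setOf_lt_im]
  exact hz.1

/-- A set of the closed half-plane lies in its sensor (`ρ ≥ 0`). [folklore] -/
theorem subset_halfNhd (hC : ∀ z ∈ C, 0 ≤ z.im) (hρ : 0 ≤ ρ) : C ⊆ halfNhd C ρ :=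
  fun z hz ↦ ⟨hC z hz, by rw [infDist_zero_of_mem hz]; exact hρ⟩

/-- Points of the closed half-plane within `ρ` of a point of `C` are in the sensor. [folklore] -/
theorem mem_halfNhd_of_dist_le (hz : 0 ≤ z.im) {c : ℂ} (hc : c ∈ C) (hd : dist z c ≤ ρ) :
    z ∈ halfNhd C ρ :=
  ⟨hz, (infDist_le_dist_of_mem hc).trans hd⟩

/-- The sensor of a bounded nonempty set is bounded. [folklore] -/
theorem isBounded_halfNhd (hC : IsBounded C) (hne : C.Nonempty) (ρ : ℝ) : IsBounded (halfNhd C ρ) := by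
  obtain ⟨R, hR⟩ := hC.subset_closedBall 0
  refine (isBounded_closedBall (x := (0 : ℂ)) (r := R + (ρ + 1))).subset fun z hz ↦ ?_
  obtain ⟨c, hc, hzc⟩ := (infDist_lt_iff hne).1 (show infDist z C < ρ + 1 by linarith [hz.2])
  rw [mem_closedBall]
  calc dist z 0 ≤ dist z c + dist c 0 := dist_triangle _ _ _
    _ ≤ (ρ + 1) + R := add_le_add hzc.le (hR hc)
    _ = R + (ρ + 1) := by ring

/-- The sensor of a bounded nonempty set is compact. [folklore] -/
theorem isCompact_halfNhd (hC : IsBounded C) (hne : C.Nonempty) (ρ : ℝ) : IsCompact (halfNhd C ρ) :=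
  Metric.isCompact_of_isClosed_isBounded (isClosed_halfNhd C ρ) (isBounded_halfNhd hC hne ρ)

/-- `0` is off the sensor when `ρ < infDist 0 C`. [folklore] -/
theorem zero_notMem_halfNhd (hρ : ρ < infDist 0 C) : (0 : ℂ) ∉ halfNhd C ρ :=
  fun h ↦ (h.2.trans_lt hρ).false

/-- **The sensor is the closure of its part in `ℍ`** (for `C ⊆ ℍ̄` nonempty and `ρ > 0`): a point
`z` of the sensor is approached by the points `z + s (c − z) + i s ρ / 2`, `s ↓ 0`, where `c ∈ C` is
almost nearest to `z`; these lie in `ℍ`, strictly within `ρ` of `c`. [folklore] -/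
theorem halfNhd_subset_closure_inter (hC : ∀ z ∈ C, 0 ≤ z.im) (hne : C.Nonempty) (hρ : 0 < ρ) :
    halfNhd C ρ ⊆ closure (halfNhd C ρ ∩ upperHalfPlaneSet) := by
  intro z hz
  rw [Metric.mem_closure_iff]
  intro ε hε
  -- the parameter `s ∈ (0, 1]` with `2 s ρ < ε`
  set s : ℝ := min 1 (ε / (4 * ρ)) with hs
  have hs0 : 0 < s := lt_min one_pos (by positivity)
  have hs1 : s ≤ 1 := min_le_left _ _
  have hsε : 2 * s * ρ < ε := by
    have h1 : s ≤ ε / (4 * ρ) := min_le_right _ _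
    have h2 : s * (4 * ρ) ≤ ε := (le_div_iff₀ (by positivity)).1 h1
    nlinarith
  -- an almost nearest point `c ∈ C`
  obtain ⟨c, hc, hzc⟩ := (infDist_lt_iff hne).1 (show infDist z C < ρ + s * ρ / 4 by
    have := hz.2; nlinarith)
  set w : ℂ := z + (s : ℂ) * (c - z) + ((s * ρ / 2 : ℝ) : ℂ) * I with hw
  have hwim : w.im = (1 - s) * z.im + s * c.im + s * ρ / 2 := by
    simp only [hw, add_im, mul_im, ofReal_re, ofReal_im, sub_im, sub_re, I_re, I_im, mul_zero,
      mul_one, zero_mul, add_zero]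
    ring
  have hwpos : 0 < w.im := by
    rw [hwim]
    have h1 : 0 ≤ (1 - s) * z.im := mul_nonneg (by linarith) hz.1
    have h2 : 0 ≤ s * c.im := mul_nonneg hs0.le (hC c hc)
    have h3 : 0 < s * ρ / 2 := by positivity
    linarith
  have hsρ : 0 < s * ρ := mul_pos hs0 hρ
  have hssρ : s * s * ρ ≤ s * ρ := by nlinarith
  have hn2 : ‖((s * ρ / 2 : ℝ) : ℂ) * I‖ = s * ρ / 2 := by
    rw [norm_mul, norm_real, norm_I, mul_one, Real.norm_of_nonneg (by positivity)]
  have hwc : dist w c < ρ := by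
    have heq : w - c = ((1 - s : ℝ) : ℂ) * (z - c) + ((s * ρ / 2 : ℝ) : ℂ) * I := by
      simp only [hw, ofReal_sub, ofReal_one]; ring
    have hn1 : ‖((1 - s : ℝ) : ℂ) * (z - c)‖ = (1 - s) * dist z c := by
      rw [norm_mul, norm_real, Real.norm_of_nonneg (by linarith), dist_eq_norm]
    rw [dist_eq_norm, heq]
    calc ‖((1 - s : ℝ) : ℂ) * (z - c) + ((s * ρ / 2 : ℝ) : ℂ) * I‖
        ≤ ‖((1 - s : ℝ) : ℂ) * (z - c)‖ + ‖((s * ρ / 2 : ℝ) : ℂ) * I‖ := norm_add_le _ _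
      _ = (1 - s) * dist z c + s * ρ / 2 := by rw [hn1, hn2]
      _ ≤ (1 - s) * (ρ + s * ρ / 4) + s * ρ / 2 :=
          add_le_add (mul_le_mul_of_nonneg_left hzc.le (sub_nonneg.2 hs1)) le_rfl
      _ = ρ - s * ρ / 4 - s * s * ρ / 4 := by ring
      _ < ρ := by nlinarith
  have hwz : dist w z < ε := by
    have heq : w - z = (s : ℂ) * (c - z) + ((s * ρ / 2 : ℝ) : ℂ) * I := by
      simp only [hw]; ring
    have hn1 : ‖(s : ℂ) * (c - z)‖ = s * dist c z := by
      rw [norm_mul, norm_real, Real.norm_of_nonneg hs0.le, dist_eq_norm]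
    rw [dist_eq_norm, heq]
    calc ‖(s : ℂ) * (c - z) + ((s * ρ / 2 : ℝ) : ℂ) * I‖
        ≤ ‖(s : ℂ) * (c - z)‖ + ‖((s * ρ / 2 : ℝ) : ℂ) * I‖ := norm_add_le _ _
      _ = s * dist c z + s * ρ / 2 := by rw [hn1, hn2]
      _ ≤ s * (ρ + s * ρ / 4) + s * ρ / 2 := by
          rw [dist_comm]; exact add_le_add (mul_le_mul_of_nonneg_left hzc.le hs0.le) le_rfl
      _ = s * ρ + s * s * ρ / 4 + s * ρ / 2 := by ring
      _ < ε := by linarith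
  refine ⟨w, ⟨mem_halfNhd_of_dist_le hwpos.le hc hwc.le, hwpos⟩, ?_⟩
  rw [dist_comm]; exact hwz

/-! ### Partial contacts and contact times -/

/-- **Partial contact of the closed hull with the cluster `C` at time `t`**: the closed hull
`K̂_t` meets the sensor of `C` while `C` is not wholly swallowed. [cite: Lawler2005, §6.3 Thm. 6.13] -/
def IsPartialContact (W : ℝ≥0 → ℝ) (C : Set ℂ) (ρ : ℝ) (t : ℝ≥0) : Prop :=
  ¬ Disjoint (closedHull W t) (halfNhd C ρ) ∧ ¬ C ⊆ closedHull W t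

/-- **The contact time of the cluster `C`**: the infimum of the times of partial contact
(`⊤` if there is none). [cite: Lawler2005, §6.3 Thm. 6.13] -/
def clusterContactTime (W : ℝ≥0 → ℝ) (C : Set ℂ) (ρ : ℝ) : WithTop ℝ≥0 :=
  ⨅ (t : ℝ≥0) (_ : IsPartialContact W C ρ t), (t : WithTop ℝ≥0)

/-- A time of partial contact bounds the contact time. [folklore] -/
theorem clusterContactTime_le {t : ℝ≥0} (h : IsPartialContact W C ρ t) :
    clusterContactTime W C ρ ≤ t :=
  iInf₂_le t h

/-- A lower bound of all times of partial contact is a lower bound of the contact time. [folklore] -/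
theorem le_clusterContactTime {u : WithTop ℝ≥0} (h : ∀ t : ℝ≥0, IsPartialContact W C ρ t → u ≤ t) :
    u ≤ clusterContactTime W C ρ :=
  le_iInf₂ h

/-- Strictly before the contact time there is no partial contact. [folklore] -/
theorem not_isPartialContact_of_coe_lt {t : ℝ≥0} (h : (t : WithTop ℝ≥0) < clusterContactTime W C ρ)
    {s : ℝ≥0} (hs : s ≤ t) : ¬ IsPartialContact W C ρ s :=
  fun hps ↦ (lt_of_lt_of_le h ((clusterContactTime_le hps).trans (WithTop.coe_le_coe.2 hs))).false

/-- No partial contact ever means an infinite contact time. [folklore] -/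
theorem clusterContactTime_eq_top (h : ∀ t, ¬ IsPartialContact W C ρ t) : clusterContactTime W C ρ = ⊤ := by
  simp only [clusterContactTime, iInf_eq_top, WithTop.coe_ne_top, imp_false]
  exact h

/-- No partial contact at an untouched-or-swallowed time, spelled out: at a time without partial
contact, either the closed hull misses the sensor of `C`, or `C` is wholly swallowed. [folklore] -/
theorem disjoint_or_subset_of_not_isPartialContact {t : ℝ≥0} (h : ¬ IsPartialContact W C ρ t) :
    Disjoint (closedHull W t) (halfNhd C ρ) ∨ C ⊆ closedHull W t := by
  by_contra hcon
  push Not at hcon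
  exact h ⟨fun hd ↦ hcon.1 hd, hcon.2⟩

/-! ### The clusters of a hull and the partial contact time -/

/-- The **family of `ρ`-clusters** of `A`. [folklore] -/
def clusterFamily (A : Set ℂ) (ρ : ℝ) : Set (Set ℂ) := {C | ∃ a ∈ A, C = deltaCluster A ρ a}

/-- The cluster of a point of `A` belongs to the family. [folklore] -/
theorem deltaCluster_mem_clusterFamily {a : ℂ} (ha : a ∈ A) : deltaCluster A ρ a ∈ clusterFamily A ρ :=
  ⟨a, ha, rfl⟩

/-- A compact set has finitely many clusters (`finite_setOf_deltaCluster`). [folklore] -/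
theorem finite_clusterFamily (hA : IsCompact A) (hρ : 0 < ρ) : (clusterFamily A ρ).Finite :=
  finite_setOf_deltaCluster hA hρ

/-- Members of the family are clusters of points of `A`, contained in `A` and nonempty. [folklore] -/
theorem subset_and_nonempty_of_mem_clusterFamily (hC : C ∈ clusterFamily A ρ) : C ⊆ A ∧ C.Nonempty := by
  obtain ⟨a, ha, rfl⟩ := hC
  exact ⟨deltaCluster_subset ha, ⟨a, mem_deltaCluster_self A ρ a⟩⟩

/-- `A` is the union of its clusters. [folklore] -/
theorem sUnion_clusterFamily (A : Set ℂ) (ρ : ℝ) : ⋃₀ clusterFamily A ρ = A := by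
  refine Subset.antisymm (sUnion_subset fun C hC ↦ (subset_and_nonempty_of_mem_clusterFamily hC).1) ?_
  exact fun a ha ↦ ⟨deltaCluster A ρ a, deltaCluster_mem_clusterFamily ha, mem_deltaCluster_self A ρ a⟩

/-- **The partial contact time of `A`**: the first time some `ρ`-cluster of `A` is partially
contacted, `min_C clusterContactTime W C ρ` over the clusters `C` of `A`.
[cite: Lawler2005, §6.3 Thm. 6.13] -/
def partialContactTime (W : ℝ≥0 → ℝ) (A : Set ℂ) (ρ : ℝ) : WithTop ℝ≥0 :=
  ⨅ C ∈ clusterFamily A ρ, clusterContactTime W C ρ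

/-- The partial contact time is at most each cluster's contact time. [folklore] -/
theorem partialContactTime_le (hC : C ∈ clusterFamily A ρ) :
    partialContactTime W A ρ ≤ clusterContactTime W C ρ :=
  iInf₂_le C hC

/-- A finite nonempty infimum in `WithTop ℝ≥0` is attained. [folklore] -/
theorem exists_biInf_eq_of_finite {ι : Type*} {s : Set ι} (hs : s.Finite) (hne : s.Nonempty)
    (f : ι → WithTop ℝ≥0) : ∃ i ∈ s, ⨅ j ∈ s, f j = f i := by
  obtain ⟨i, hi, hmin⟩ := Set.exists_min_image s f hs hne
  exact ⟨i, hi, le_antisymm (iInf₂_le i hi) (le_iInf₂ hmin)⟩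

/-- **Strictly before the partial contact time no cluster is partially contacted** (and conversely,
for compact `A`: the minimum over the finitely many clusters is attained). [folklore] -/
theorem coe_lt_partialContactTime_iff (hA : IsCompact A) (hρ : 0 < ρ) {t : ℝ≥0} :
    (t : WithTop ℝ≥0) < partialContactTime W A ρ ↔
      ∀ C ∈ clusterFamily A ρ, (t : WithTop ℝ≥0) < clusterContactTime W C ρ := by
  refine ⟨fun h C hC ↦ lt_of_lt_of_le h (partialContactTime_le hC), fun h ↦ ?_⟩
  rcases (clusterFamily A ρ).eq_empty_or_nonempty with hemp | hne
  · rw [partialContactTime, hemp, iInf_emptyset]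
    exact WithTop.coe_lt_top t
  · obtain ⟨C, hC, heq⟩ := exists_biInf_eq_of_finite (finite_clusterFamily hA hρ) hne
      (fun C ↦ clusterContactTime W C ρ)
    rw [partialContactTime, heq]
    exact h C hC

/-- The partial contact time of a compact set is one of the cluster contact times, or `⊤` when
there is no cluster. [folklore] -/
theorem partialContactTime_eq_top_or_exists (hA : IsCompact A) (hρ : 0 < ρ) :
    partialContactTime W A ρ = ⊤ ∨
      ∃ C ∈ clusterFamily A ρ, partialContactTime W A ρ = clusterContactTime W C ρ := by
  rcases (clusterFamily A ρ).eq_empty_or_nonempty with hemp | hne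
  · left
    rw [partialContactTime, hemp, iInf_emptyset]
  · right
    exact exists_biInf_eq_of_finite (finite_clusterFamily hA hρ) hne _

end Loewner

end Literature.Probability.RandomPlanarGeometry

end
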